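import Literature.Analysis.FluidPDE.Tao2016AveragedNS.SeedScaleFiring
import HarnessLib

/-!
# Timing of the forced gate: quiet on `[0, 7/5]`, fired on `[7/4, 2]` and on `[2, T]`

Cell `pub-fluidc`, blueprint seat 1 (gen 13) — the TIMED form of Theorem 5.3 for approximate
trajectories at the seed scale, and the persistence of the fired state to the end of the window.
HONEST FRAMING: low prior, high value-of-information experiment on Tao's machine paradigm
[Tao2016AveragedNS, §5.5]; NOT a claim that NS blows up.

SeedScaleFiring.lean proved that every differentiable approximate trajectory of a member
`delayCircuitWith K M ε` within the seed-scale budget `δ₀ + δT ≤ ε²e^{-M}/(8√M)` has a critical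
time `τ ∈ (1, 8/5]` (first hitting time of `c = ε²K⁻¹⁰`) and is in the fired state on `[7/4, 2]`.
Here the lower bound on `τ` is sharpened to the paper's scale: the a-priori envelope of the trigger
(`Ignition.c_le`, `Ignition.c_ge`, majorant clock `G⁺(t) ≤ Mt²/2 + t²/16000 + t/320`) gives
`|c(t)| ≤ 2ε²e^{-M}e^{G⁺(t)} ≤ 2e^{1/100}ε²e^{-M/50} < ε²K⁻¹⁰` for `t ≤ 7/5` (as `M ≥ 3000 log K`),
so `τ > 7/5` (Tao: `t_c ≈ √2`):

* `Ignition.abs_c_lt_level_early`: `|c(t)| < ε²K⁻¹⁰` on `[0, 7/5]`;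
* `approxTrajectory_criticalTime_window`: the critical time lies in `(7/5, 8/5]`, with the entry
  data of `triggerLevel_hit`;
* `approxTrajectory_transition_timed`: QUIET on the fixed window `[0, 7/5]` (`|ã|, |d| ≤ 4K⁻¹⁰`,
  `|c| < ε²K⁻¹⁰`) and FIRED on the fixed window `[7/4, 2]` (`|ã - 1| ≤ 4K⁻²⁰`,
  `|a|, |b|, |c|, |d| ≤ 2K⁻¹⁰`) — fixed margins are what a clocked assembly consumes;
* `approxTrajectory_transition_timed_pow`: the same under the K-power budget
  `δ₀ + δT ≤ ε²e^{-M}/K⁶` (`8√M ≤ K⁶` on `M ≤ K¹⁰`);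
* `approxTrajectory_fired_from_two`: the fired state PERSISTS on all of `[2, T]`
  (`|ã - 1| ≤ 6K⁻²⁰`, `|a|, |b|, |c|, |d| ≤ 4K⁻¹⁰`) — after `t = 2` no mode dynamics is needed: the
  output is almost monotone, the energy almost conserved (`≤ 1 + 20ε²`), so the four modes carry at
  most `energy - ã² ≤ 8K⁻²⁰ + 22ε²`;
* `approxTrajectory_seedBudget_fires`: under `δ₀ + δT ≤ ε²e^{-M}/K⁶`, fired with tolerance `1/4`
  at every time in `[2, T]` — literally the conclusion of the cell's typed seed-scale question
  `PseudoOrbitTransitionSeed 6` (NegativeKickSharp.lean), established here for DIFFERENTIABLE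
  approximate trajectories (velocity function, two-sided derivative); the typed question itself
  quantifies over right-differentiable pseudo-orbits (`IsPseudoOrbit`) and is not decided here;
* `ApproxTrajectoryTransitionSeed q`: the seed-scale question typed over differentiable approximate
  trajectories (implied by `PseudoOrbitTransitionSeed q`: `PseudoOrbitTransitionSeed.approx`, via
  `IsPseudoOrbit.of_hasDerivAt_approx`), and `approxTrajectoryTransitionSeed_six` /
  `approxTrajectoryTransitionSeed_of_six_le`: it HOLDS for every `q ≥ 6`. What separates this from
  `PseudoOrbitTransitionSeed 6` is only the one-sided differentiability of a general pseudo-orbit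
  (the port of the chain to right derivatives; its toolkit is PseudoOrbitPersistence.lean).

Layout note: the lemmas of `section Seed` whose proofs use the budget only through
`budget_facts'` (`δ₀ + 2δ ≤ ε²e^{-M}/8`) are proved under that WEAK budget in `section Eighth` (primed
names) and re-exported with unchanged statements under the seed-scale budget `ε²e^{-M}/(8√M)`, so that
the sharp-budget chain (SeedScaleSharp*.lean) can reuse them.
-/

namespace Literature.Analysis.FluidPDE.Tao2016AveragedNS

open Real Set MeasureTheory
open scoped NNReal
open NegKick (clockInt clockInt_zero)

namespace Ignition

section Approx

variable {K M ε δ δ₀ T : ℝ} {Y V : ℝ → Fin 5 → ℝ}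
  (hY : ∀ t, HasDerivAt Y (V t) t)
  (hV : ∀ t ∈ Ico 0 T, ‖V t - delayCircuitWith K M ε (Y t)‖ ≤ δ)
  (hR : ∀ t ∈ Ico 0 T, ‖Y t‖ ≤ 2) (hT : 2 ≤ T)
include hY hV hR hT

section Eighth

/-! ### The same, under the WEAK budget `δ₀ + 2δ ≤ ε²e^{-M}/8` (primed names; the unprimed
names below re-export them under the seed-scale budget with unchanged statements) -/

variable (hK : 2 * 20 ^ 42 * (Nat.factorial 42 : ℝ) + 16 ≤ K) (hML : 3000 * Real.log K ≤ M)
  (hMK : M ≤ K ^ 10) (hε : 0 < ε) (hεle : ε ≤ exp (-(10 * M)) / K ^ 100)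
  (h0 : ‖Y 0 - delayInit‖ ≤ δ₀) (hη : δ₀ + 2 * δ ≤ ε ^ 2 * exp (-M) / 8)
include hK hML hMK hε hεle h0 hη

/-- **The trigger stays below the critical level up to time `7/5`**: `|c(t)| < ε²K⁻¹⁰` for
`t ∈ [0, 7/5]` (a-priori envelope `|c| ≤ 2ε²e^{-M}e^{G⁺}`, `G⁺(t) ≤ (49/50)M + 1/100`, and
`e^{-M/50} ≤ K⁻⁶⁰` from `M ≥ 3000 log K`). [cite: Tao2016AveragedNS, §5.5 (definition of t_c)] -/
theorem abs_c_lt_level_early' {t : ℝ} (ht : t ∈ Icc (0 : ℝ) (7 / 5)) :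
    |Y t 2| < ε ^ 2 / K ^ 10 := by
  obtain ⟨hM6000, -, -, -, -, -, -, -, -⟩ := ignition_params hK hML hMK hε hεle
  obtain ⟨hδ₀, hδ, hη8, hδ₀1, -, hs1⟩ := budget_facts' hV hT hK hML hMK hε hεle h0 hη
  obtain ⟨hK16, -, -, -, -, -⟩ := negKick_params hK hML hMK hε hεle
  have hK0 : 0 < K := by linarith
  have hK1 : 1 ≤ K := by linarith
  have hM : 0 ≤ M := by linarith
  have ht' : t ∈ Icc (0 : ℝ) (8 / 5) := ⟨ht.1, by linarith [ht.2]⟩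
  have hup := c_le hY hV hR hT h0 hδ₀1 hε hM ht'
  have hlo := c_ge hY hV hR hT h0 hδ₀1 hε hM ht'
  -- the majorant clock
  have hG : clockSup M ε δ δ₀ t ≤ 49 / 50 * M + 1 / 100 := by
    have h1 := clockSup_le' hV hT hK hML hMK hε hεle h0 hη ht'
    have ht2 : t ^ 2 ≤ (7 / 5) ^ 2 := pow_le_pow_left₀ ht.1 ht.2 2
    have h2 : M * t ^ 2 ≤ M * (7 / 5) ^ 2 := mul_le_mul_of_nonneg_left ht2 hM
    have h3 : t ^ 2 / 16000 + t / 320 ≤ 1 / 100 := by linarith [ht.2]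
    linarith
  have hs0 : 0 < ε ^ 2 * exp (-M) := by positivity
  -- the prefactors are at most `2ε²e^{-M}`
  have hpre : δ₀ + (ε ^ 2 * exp (-M) * (1 + 7 * δ₀ + 32 * δ) + δ) * t ≤
      2 * (ε ^ 2 * exp (-M)) := by
    have h1 : ε ^ 2 * exp (-M) * (1 + 7 * δ₀ + 32 * δ) ≤ ε ^ 2 * exp (-M) * (1 + 2 / 1000000) :=
      mul_le_mul_of_nonneg_left (by linarith) hs0.le
    have h2 : (ε ^ 2 * exp (-M) * (1 + 7 * δ₀ + 32 * δ) + δ) * t ≤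
        (ε ^ 2 * exp (-M) * (1 + 2 / 1000000) + δ) * (7 / 5) :=
      mul_le_mul (by linarith) ht.2 ht.1 (by positivity)
    linarith
  have hpre' : δ₀ + δ * t ≤ 2 * (ε ^ 2 * exp (-M)) := by
    have : δ * t ≤ δ * (7 / 5) := mul_le_mul_of_nonneg_left ht.2 hδ
    linarith
  -- the exponential factor
  have hE0 : 0 ≤ exp (clockSup M ε δ δ₀ t) := (exp_pos _).le
  have hexpG : exp (clockSup M ε δ δ₀ t) ≤ exp (49 / 50 * M + 1 / 100) := exp_le_exp.2 hG
  have habs : |Y t 2| ≤ 2 * (ε ^ 2 * exp (-M)) * exp (49 / 50 * M + 1 / 100) := by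
    rw [abs_le]; constructor
    · have : (δ₀ + δ * t) * exp (clockSup M ε δ δ₀ t) ≤
          2 * (ε ^ 2 * exp (-M)) * exp (49 / 50 * M + 1 / 100) :=
        mul_le_mul hpre' hexpG hE0 (by positivity)
      linarith
    · have : (δ₀ + (ε ^ 2 * exp (-M) * (1 + 7 * δ₀ + 32 * δ) + δ) * t) *
            exp (clockSup M ε δ δ₀ t) ≤
          2 * (ε ^ 2 * exp (-M)) * exp (49 / 50 * M + 1 / 100) :=
        mul_le_mul hpre hexpG hE0 (by positivity)
      linarith
  -- `2ε²e^{-M}e^{(49/50)M + 1/100} = 2e^{1/100}ε²e^{-M/50} < ε²K⁻¹⁰`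
  have e1 : exp (-M) * exp (49 / 50 * M + 1 / 100) = exp (1 / 100) * exp (-(M / 50)) := by
    rw [← exp_add, ← exp_add]; congr 1; ring
  have he100 : exp (1 / 100 : ℝ) ≤ 100 / 99 := by
    have h := add_one_le_exp (-(1 / 100 : ℝ))
    have h' : exp (1 / 100 : ℝ) * exp (-(1 / 100 : ℝ)) = 1 := by rw [← exp_add]; simp
    nlinarith [exp_pos (1 / 100 : ℝ), exp_pos (-(1 / 100 : ℝ))]
  have h50 : exp (-(M / 50)) ≤ (K ^ 60)⁻¹ := by
    have h1 : exp (-(M / 50)) ≤ exp (-(60 * Real.log K)) := exp_le_exp.2 (by linarith)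
    have h2 : exp (-(60 * Real.log K)) = (K ^ 60)⁻¹ := by
      rw [exp_neg, show (60 : ℝ) * Real.log K = ((60 : ℕ) : ℝ) * Real.log K by norm_num,
        exp_nat_mul, exp_log hK0]
    rw [← h2]; exact h1
  have hfin : 2 * (100 / 99) * (K ^ 60)⁻¹ < 1 / K ^ 10 := by
    rw [← one_div, show 2 * (100 / 99) * (1 / K ^ 60) = (200 / 99) / K ^ 60 by ring,
      div_lt_div_iff₀ (by positivity) (by positivity)]
    have h50' : (4 : ℝ) ≤ K ^ 50 :=
      le_trans (by linarith : (4 : ℝ) ≤ K) (le_self_pow₀ hK1 (by norm_num))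
    have : (200 / 99 : ℝ) * K ^ 10 < K ^ 50 * K ^ 10 := by
      have hK10 : (0 : ℝ) < K ^ 10 := by positivity
      nlinarith
    calc (200 / 99 : ℝ) * K ^ 10 < K ^ 50 * K ^ 10 := this
      _ = 1 * K ^ 60 := by ring
  have hchain : 2 * (ε ^ 2 * exp (-M)) * exp (49 / 50 * M + 1 / 100) < ε ^ 2 / K ^ 10 := by
    have e2 : 2 * (ε ^ 2 * exp (-M)) * exp (49 / 50 * M + 1 / 100) =
        ε ^ 2 * (2 * (exp (1 / 100) * exp (-(M / 50)))) := by
      rw [show 2 * (ε ^ 2 * exp (-M)) * exp (49 / 50 * M + 1 / 100) =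
        ε ^ 2 * (2 * (exp (-M) * exp (49 / 50 * M + 1 / 100))) by ring, e1]
    rw [e2, show ε ^ 2 / K ^ 10 = ε ^ 2 * (1 / K ^ 10) by ring]
    refine mul_lt_mul_of_pos_left ?_ (by positivity)
    have h3 : exp (1 / 100) * exp (-(M / 50)) ≤ 100 / 99 * (K ^ 60)⁻¹ :=
      mul_le_mul he100 h50 (exp_pos _).le (by norm_num)
    linarith
  exact lt_of_le_of_lt habs hchain

end Eighth

section Seed

variable (hK : 2 * 20 ^ 42 * (Nat.factorial 42 : ℝ) + 16 ≤ K) (hML : 3000 * Real.log K ≤ M)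
  (hMK : M ≤ K ^ 10) (hε : 0 < ε) (hεle : ε ≤ exp (-(10 * M)) / K ^ 100)
  (h0 : ‖Y 0 - delayInit‖ ≤ δ₀) (hη : δ₀ + 2 * δ ≤ ε ^ 2 * exp (-M) / (8 * Real.sqrt M))
include hK hML hMK hε hεle h0 hη

/-- **The trigger stays below the critical level up to time `7/5`**: `|c(t)| < ε²K⁻¹⁰` for
`t ∈ [0, 7/5]` (a-priori envelope `|c| ≤ 2ε²e^{-M}e^{G⁺}`, `G⁺(t) ≤ (49/50)M + 1/100`, and
`e^{-M/50} ≤ K⁻⁶⁰` from `M ≥ 3000 log K`). [cite: Tao2016AveragedNS, §5.5 (definition of t_c)] -/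
theorem abs_c_lt_level_early {t : ℝ} (ht : t ∈ Icc (0 : ℝ) (7 / 5)) :
    |Y t 2| < ε ^ 2 / K ^ 10 :=
  abs_c_lt_level_early' hY hV hR hT hK hML hMK hε hεle h0
    (budget_le_eighth hK hML hMK hε hεle hη) ht

end Seed

end Approx

end Ignition

/-! ## Exported statements -/

/-- **The critical time of a forced gate lies in `(7/5, 8/5]`.** Under the hypotheses of
`triggerLevel_hit` (standing hypotheses, differentiable approximate trajectory with sup-defect `δ`
and sup-norm `≤ 2` on `[0,T)`, `T ≥ 2`, datum `δ₀`-close to (5.6), `δ₀ + δT ≤ ε²e^{-M}/(8√M)`), the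
first hitting time `τ` of the level `c = ε²K⁻¹⁰` satisfies `7/5 < τ ≤ 8/5`, with the entry data of
`triggerLevel_hit`. (Tao: `t_c ≈ √2` for the exact flow.) [cite: Tao2016AveragedNS, §5.5] -/
theorem approxTrajectory_criticalTime_window (K M ε δ δ₀ T : ℝ) (Y V : ℝ → Fin 5 → ℝ)
    (hK : 2 * 20 ^ 42 * (Nat.factorial 42 : ℝ) + 16 ≤ K) (hML : 3000 * Real.log K ≤ M)
    (hMK : M ≤ K ^ 10) (hε : 0 < ε) (hεle : ε ≤ exp (-(10 * M)) / K ^ 100) (hT : 2 ≤ T)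
    (hY : ∀ t, HasDerivAt Y (V t) t)
    (hV : ∀ t ∈ Ico 0 T, ‖V t - delayCircuitWith K M ε (Y t)‖ ≤ δ)
    (hR : ∀ t ∈ Ico 0 T, ‖Y t‖ ≤ 2) (h0 : ‖Y 0 - delayInit‖ ≤ δ₀)
    (hB : δ₀ + δ * T ≤ ε ^ 2 * exp (-M) / (8 * Real.sqrt M)) :
    ∃ τ ∈ Ioc (7 / 5 : ℝ) (8 / 5), Y τ 2 = ε ^ 2 / K ^ 10 ∧
      (∀ t ∈ Ico (0 : ℝ) τ, |Y t 2| < ε ^ 2 / K ^ 10) ∧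
      (∀ t ∈ Icc (Real.sqrt M)⁻¹ τ, 0 < Y t 2) ∧
      (∀ t ∈ Icc (1 : ℝ) τ, 49 / 50 * ε ≤ Y t 1) ∧
      (∀ t ∈ Icc (0 : ℝ) τ, |Y t 1| ≤ 2 * ε ∧ 999 / 1000 ≤ Y t 0 ^ 2 ∧
        |Y t 3| ≤ 4 / K ^ 10 ∧ |Y t 4| ≤ 4 / K ^ 10) := by
  have hδ : 0 ≤ δ := Ignition.defect_nonneg hV hT
  have hη : δ₀ + 2 * δ ≤ ε ^ 2 * exp (-M) / (8 * Real.sqrt M) := by nlinarith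
  obtain ⟨τ, hτ, hcτ, hbefore, hpos, hblate, hwin⟩ :=
    Ignition.exists_triggerLevel_hit hY hV hR hT hK hML hMK hε hεle h0 hη
  have hτ75 : 7 / 5 < τ := by
    by_contra hle
    have h := Ignition.abs_c_lt_level_early hY hV hR hT hK hML hMK hε hεle h0 hη
      ⟨by linarith [hτ.1], le_of_not_gt hle⟩
    rw [hcτ, abs_of_nonneg (by positivity)] at h
    exact lt_irrefl _ h
  exact ⟨τ, ⟨hτ75, hτ.2⟩, hcτ, hbefore, hpos, hblate, hwin⟩

/-- **Theorem 5.3 for approximate trajectories at the seed scale, TIMED form.** For every member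
`delayCircuitWith K M ε` under the standing hypotheses and every differentiable approximate
trajectory `Y` (velocity `V`, sup-defect `≤ δ` and sup-norm `≤ 2` on `[0,T)`, `T ≥ 2`) issued
`δ₀`-close to Tao's datum (5.6) with `δ₀ + δT ≤ ε²e^{-M}/(8√M)`: the trajectory is QUIET on the
fixed window `[0, 7/5]` — `|ã|, |d| ≤ 4K⁻¹⁰`, `|c| < ε²K⁻¹⁰`, `|b| ≤ 2ε`, `a² ≥ 0.999` — and FIRED
on the fixed window `[7/4, 2]` — `|ã - 1| ≤ 4K⁻²⁰`, `|a|, |b|, |c|, |d| ≤ 2K⁻¹⁰`.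
[cite: Tao2016AveragedNS, §5.5 Theorem 5.3] -/
theorem approxTrajectory_transition_timed (K M ε δ δ₀ T : ℝ) (Y V : ℝ → Fin 5 → ℝ)
    (hK : 2 * 20 ^ 42 * (Nat.factorial 42 : ℝ) + 16 ≤ K) (hML : 3000 * Real.log K ≤ M)
    (hMK : M ≤ K ^ 10) (hε : 0 < ε) (hεle : ε ≤ exp (-(10 * M)) / K ^ 100) (hT : 2 ≤ T)
    (hY : ∀ t, HasDerivAt Y (V t) t)
    (hV : ∀ t ∈ Ico 0 T, ‖V t - delayCircuitWith K M ε (Y t)‖ ≤ δ)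
    (hR : ∀ t ∈ Ico 0 T, ‖Y t‖ ≤ 2) (h0 : ‖Y 0 - delayInit‖ ≤ δ₀)
    (hB : δ₀ + δ * T ≤ ε ^ 2 * exp (-M) / (8 * Real.sqrt M)) :
    (∀ t ∈ Icc (0 : ℝ) (7 / 5), |Y t 4| ≤ 4 / K ^ 10 ∧ |Y t 3| ≤ 4 / K ^ 10 ∧
        |Y t 2| < ε ^ 2 / K ^ 10 ∧ |Y t 1| ≤ 2 * ε ∧ 999 / 1000 ≤ Y t 0 ^ 2) ∧
      ∀ t ∈ Icc (7 / 4 : ℝ) 2,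
        |Y t 4 - 1| ≤ 4 / K ^ 20 ∧ ∀ i : Fin 5, i ≠ 4 → |Y t i| ≤ 2 / K ^ 10 := by
  obtain ⟨τ, hτ, -, hbefore, -, -, hwin⟩ :=
    approxTrajectory_criticalTime_window K M ε δ δ₀ T Y V hK hML hMK hε hεle hT hY hV hR h0 hB
  refine ⟨fun t ht => ?_,
    approxTrajectory_fired_at_two K M ε δ δ₀ T Y V hK hML hMK hε hεle hT hY hV hR h0 hB⟩
  have htτ : t ∈ Icc (0 : ℝ) τ := ⟨ht.1, by linarith [ht.2, hτ.1]⟩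
  obtain ⟨hb, ha, hd, he⟩ := hwin t htτ
  exact ⟨he, hd, hbefore t ⟨ht.1, by linarith [ht.2, hτ.1]⟩, hb, ha⟩

namespace Ignition

/-- Closure at the right end of a window: a continuous `g` with `g ≤ c` on `[a, T)`, `a < T`, has
`g T ≤ c`. [folklore] -/
theorem le_at_right_of_Ico {g : ℝ → ℝ} (hg : Continuous g) {a c T : ℝ} (ha : a < T)
    (h : ∀ t ∈ Ico a T, g t ≤ c) : g T ≤ c := by
  have hS : IsClosed {t | g t ≤ c} := isClosed_le hg continuous_const
  have hsub : closure (Ico a T) ⊆ {t | g t ≤ c} := closure_minimal (fun t ht => h t ht) hS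
  rw [closure_Ico ha.ne] at hsub
  exact hsub ⟨ha.le, le_rfl⟩

/-- Two distinct modes' squares are at most the energy. [folklore] -/
theorem sq_add_sq_le_energy (p : Fin 5 → ℝ) {i j : Fin 5} (hij : i ≠ j) :
    p i ^ 2 + p j ^ 2 ≤ energy p := by
  unfold energy
  calc p i ^ 2 + p j ^ 2 = ∑ k ∈ ({i, j} : Finset (Fin 5)), p k ^ 2 :=
        (Finset.sum_pair (f := fun k => p k ^ 2) hij).symm
    _ ≤ ∑ k, p k ^ 2 :=
        Finset.sum_le_sum_of_subset_of_nonneg (Finset.subset_univ _) fun k _ _ => sq_nonneg (p k)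

/-- On the admissible range `M ≤ K¹⁰` one has `8√M ≤ 8K⁵ ≤ K⁶`, so the K-power budget
`ε²e^{-M}/K⁶` is below the seed-scale budget `ε²e^{-M}/(8√M)`. [folklore] -/
theorem seedBudget_pow_le {K M ε : ℝ} (hK : 2 * 20 ^ 42 * (Nat.factorial 42 : ℝ) + 16 ≤ K)
    (hML : 3000 * Real.log K ≤ M) (hMK : M ≤ K ^ 10) (hε : 0 < ε)
    (hεle : ε ≤ exp (-(10 * M)) / K ^ 100) :
    ε ^ 2 * exp (-M) / K ^ 6 ≤ ε ^ 2 * exp (-M) / (8 * Real.sqrt M) := by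
  obtain ⟨-, -, -, -, -, -, -, h77, -⟩ := ignition_params hK hML hMK hε hεle
  obtain ⟨hK16, -, -, -, -, -⟩ := negKick_params hK hML hMK hε hεle
  have hK0 : (0 : ℝ) < K := by linarith
  have hsM : Real.sqrt M ≤ K ^ 5 := by
    calc Real.sqrt M ≤ Real.sqrt (K ^ 10) := Real.sqrt_le_sqrt hMK
      _ = K ^ 5 := by rw [show K ^ 10 = (K ^ 5) ^ 2 by ring, Real.sqrt_sq (by positivity)]
  have h8 : 8 * Real.sqrt M ≤ K ^ 6 := by
    calc 8 * Real.sqrt M ≤ K * K ^ 5 := mul_le_mul (by linarith) hsM (by linarith) hK0.le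
      _ = K ^ 6 := by ring
  have h8pos : 0 < 8 * Real.sqrt M := by linarith
  exact div_le_div_of_nonneg_left (by positivity) h8pos h8

end Ignition

/-- **K-power form of the budget.** On the admissible range `M ≤ K¹⁰` one has `8√M ≤ 8K⁵ ≤ K⁶`, so
the structured budget `δ₀ + δT ≤ ε²e^{-M}/K⁶` is below `ε²e^{-M}/(8√M)` and the timed transition
holds under it: quiet on `[0, 7/5]`, fired on `[7/4, 2]`. [cite: Tao2016AveragedNS, §5.5 Theorem 5.3] -/
theorem approxTrajectory_transition_timed_pow (K M ε δ δ₀ T : ℝ) (Y V : ℝ → Fin 5 → ℝ)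
    (hK : 2 * 20 ^ 42 * (Nat.factorial 42 : ℝ) + 16 ≤ K) (hML : 3000 * Real.log K ≤ M)
    (hMK : M ≤ K ^ 10) (hε : 0 < ε) (hεle : ε ≤ exp (-(10 * M)) / K ^ 100) (hT : 2 ≤ T)
    (hY : ∀ t, HasDerivAt Y (V t) t)
    (hV : ∀ t ∈ Ico 0 T, ‖V t - delayCircuitWith K M ε (Y t)‖ ≤ δ)
    (hR : ∀ t ∈ Ico 0 T, ‖Y t‖ ≤ 2) (h0 : ‖Y 0 - delayInit‖ ≤ δ₀)
    (hB : δ₀ + δ * T ≤ ε ^ 2 * exp (-M) / K ^ 6) :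
    (∀ t ∈ Icc (0 : ℝ) (7 / 5), |Y t 4| ≤ 4 / K ^ 10 ∧ |Y t 3| ≤ 4 / K ^ 10 ∧
        |Y t 2| < ε ^ 2 / K ^ 10 ∧ |Y t 1| ≤ 2 * ε ∧ 999 / 1000 ≤ Y t 0 ^ 2) ∧
      ∀ t ∈ Icc (7 / 4 : ℝ) 2,
        |Y t 4 - 1| ≤ 4 / K ^ 20 ∧ ∀ i : Fin 5, i ≠ 4 → |Y t i| ≤ 2 / K ^ 10 :=
  approxTrajectory_transition_timed K M ε δ δ₀ T Y V hK hML hMK hε hεle hT hY hV hR h0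
    (hB.trans (Ignition.seedBudget_pow_le hK hML hMK hε hεle))

/-! ## §3. After the cycle: the fired state persists on `[2, T]` -/

/-- **Fired from `t = 2` to the end of the window.** Under the hypotheses of
`approxTrajectory_fired_at_two`, the fired state persists on all of `[2, T]`:
`|ã - 1| ≤ 6K⁻²⁰` and `|a|, |b|, |c|, |d| ≤ 4K⁻¹⁰`. No dynamics of the four modes is needed after
`t = 2`: the output is almost monotone (`ã(t) ≥ ã(2) - δ(t-2) ≥ 1 - 4K⁻²⁰ - ε²`), the energy is
almost conserved (`energy ≤ 1 + 7δ₀ + 20δT ≤ 1 + 20ε²`), so `ã ≤ 1 + 20ε²` and the other modes carry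
at most `energy - ã² ≤ 8K⁻²⁰ + 22ε²`; the end point `t = T` by continuity.
[cite: Tao2016AveragedNS, §5.5 Theorem 5.3, (able), (energy-con)] -/
theorem approxTrajectory_fired_from_two (K M ε δ δ₀ T : ℝ) (Y V : ℝ → Fin 5 → ℝ)
    (hK : 2 * 20 ^ 42 * (Nat.factorial 42 : ℝ) + 16 ≤ K) (hML : 3000 * Real.log K ≤ M)
    (hMK : M ≤ K ^ 10) (hε : 0 < ε) (hεle : ε ≤ exp (-(10 * M)) / K ^ 100) (hT : 2 ≤ T)
    (hY : ∀ t, HasDerivAt Y (V t) t)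
    (hV : ∀ t ∈ Ico 0 T, ‖V t - delayCircuitWith K M ε (Y t)‖ ≤ δ)
    (hR : ∀ t ∈ Ico 0 T, ‖Y t‖ ≤ 2) (h0 : ‖Y 0 - delayInit‖ ≤ δ₀)
    (hB : δ₀ + δ * T ≤ ε ^ 2 * exp (-M) / (8 * Real.sqrt M)) :
    ∀ t ∈ Icc 2 T, |Y t 4 - 1| ≤ 6 / K ^ 20 ∧ ∀ i : Fin 5, i ≠ 4 → |Y t i| ≤ 4 / K ^ 10 := by
  have hδ : 0 ≤ δ := Ignition.defect_nonneg hV hT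
  have hδ₀ : 0 ≤ δ₀ := (norm_nonneg _).trans h0
  have hη : δ₀ + 2 * δ ≤ ε ^ 2 * exp (-M) / (8 * Real.sqrt M) := by nlinarith
  obtain ⟨-, -, -, hδ₀1, -, -⟩ := Ignition.budget_facts hV hT hK hML hMK hε hεle h0 hη
  obtain ⟨hε100, -, -, -, -, -, -, -⟩ := Ignition.firing_params hV hT hK hML hMK hε hεle h0 hη
  obtain ⟨hM6000, hε1, -, -, hMε, -, -, h77, -⟩ := Ignition.ignition_params hK hML hMK hε hεle
  obtain ⟨hK16, -, -, -, -, -⟩ := negKick_params hK hML hMK hε hεle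
  have hK0 : (0 : ℝ) < K := by linarith
  have hK1 : (1 : ℝ) ≤ K := by linarith
  -- the budget is below `ε²`, and `40ε² ≤ 1/K²⁰`
  have hbud : δ₀ + δ * T ≤ ε ^ 2 := by
    refine hB.trans ?_
    rw [div_le_iff₀ (by linarith : (0 : ℝ) < 8 * Real.sqrt M)]
    have hexp : exp (-M) ≤ 1 := by rw [exp_le_one_iff]; linarith
    calc ε ^ 2 * exp (-M) ≤ ε ^ 2 * 1 := mul_le_mul_of_nonneg_left hexp (sq_nonneg ε)
      _ ≤ ε ^ 2 * (8 * Real.sqrt M) := mul_le_mul_of_nonneg_left (by linarith) (sq_nonneg ε)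
  have hK20 : 1 / K ^ 100 ≤ 1 / K ^ 20 :=
    one_div_le_one_div_of_le (by positivity) (pow_le_pow_right₀ hK1 (by norm_num))
  have h40ε : 40 * ε ^ 2 ≤ 1 / K ^ 20 := by
    have h1 : 40 * ε ≤ 1 := by nlinarith
    have h2 : 40 * ε ^ 2 ≤ ε := by nlinarith
    exact h2.trans (hε100.trans hK20)
  have hε2 : ε ^ 2 ≤ 1 / K ^ 20 := by nlinarith [sq_nonneg ε]
  have hK20s : 1 / K ^ 20 ≤ 1 / 16 :=
    one_div_le_one_div_of_le (by norm_num) (le_trans hK16 (le_self_pow₀ hK1 (by norm_num)))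
  have r4 : (4 : ℝ) / K ^ 20 = 4 * (1 / K ^ 20) := by ring
  have r6 : (6 : ℝ) / K ^ 20 = 6 * (1 / K ^ 20) := by ring
  -- the fired state at `t = 2`
  obtain ⟨he2, hi2⟩ := approxTrajectory_fired_at_two K M ε δ δ₀ T Y V hK hML hMK hε hεle hT hY
    hV hR h0 hB 2 ⟨by norm_num, le_rfl⟩
  rw [r4] at he2
  -- the bounds on `[2, T)`
  have key : ∀ t ∈ Ico 2 T,
      |Y t 4 - 1| ≤ 6 / K ^ 20 ∧ ∀ i : Fin 5, i ≠ 4 → |Y t i| ≤ 4 / K ^ 10 := by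
    intro t ht
    have ht0T : t ∈ Ico 0 T := ⟨by linarith [ht.1], ht.2⟩
    -- almost-monotone output
    have hmono : Y 2 4 - δ * (t - 2) ≤ Y t 4 :=
      Ignition.e_sub_ge_late hY hV ht.2 hK0.le (by norm_num) ht.1 le_rfl
    have hδt : δ * (t - 2) ≤ ε ^ 2 := by
      have : δ * (t - 2) ≤ δ * T := mul_le_mul_of_nonneg_left (by linarith [ht.2]) hδ
      linarith
    have he_lo : 1 - 4 * (1 / K ^ 20) - ε ^ 2 ≤ Y t 4 := by linarith [(abs_le.1 he2).1]
    -- almost-conserved energy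
    have hE := Ignition.abs_energy_sub_le hY hV hR ht0T
    have hE0 := Ignition.abs_energy_init_le h0 hδ₀1
    have h20 : 20 * δ * t ≤ 20 * (δ * T) := by nlinarith [ht.2]
    have hEt : energy (Y t) ≤ 1 + 20 * ε ^ 2 := by
      linarith [(abs_le.1 hE).2, (abs_le.1 hE0).2]
    have he_sq := Ignition.sq_le_energy (Y t) 4
    have he_hi : Y t 4 - 1 ≤ 20 * ε ^ 2 := by
      by_cases h1 : 1 ≤ Y t 4
      · have hid : (Y t 4 - 1) * (Y t 4 + 1) = Y t 4 ^ 2 - 1 := by ring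
        have hprod : (Y t 4 - 1) * (Y t 4 + 1) ≤ 20 * ε ^ 2 := by rw [hid]; linarith
        calc Y t 4 - 1 = (Y t 4 - 1) * 1 := by ring
          _ ≤ (Y t 4 - 1) * (Y t 4 + 1) := mul_le_mul_of_nonneg_left (by linarith) (by linarith)
          _ ≤ 20 * ε ^ 2 := hprod
      · linarith [sq_nonneg ε]
    refine ⟨?_, fun i hi => ?_⟩
    · rw [r6, abs_le]
      constructor <;> linarith
    · -- the other modes carry at most `energy - ã²`
      have hsum := Ignition.sq_add_sq_le_energy (Y t) hi
      have hμ0 : 0 ≤ 1 - 4 * (1 / K ^ 20) - ε ^ 2 := by linarith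
      have hesq : (1 - 4 * (1 / K ^ 20) - ε ^ 2) ^ 2 ≤ Y t 4 ^ 2 := pow_le_pow_left₀ hμ0 he_lo 2
      have hexp2 : 1 - 2 * (4 * (1 / K ^ 20) + ε ^ 2) ≤ (1 - 4 * (1 / K ^ 20) - ε ^ 2) ^ 2 := by
        nlinarith [sq_nonneg (4 * (1 / K ^ 20) + ε ^ 2)]
      have hsq : Y t i ^ 2 ≤ (4 / K ^ 10) ^ 2 := by
        have r16 : ((4 : ℝ) / K ^ 10) ^ 2 = 16 * (1 / K ^ 20) := by ring
        rw [r16]; linarith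
      exact abs_le_of_sq_le_sq hsq (by positivity)
  -- the end point `t = T` by continuity
  intro t ht
  by_cases htT : t < T
  · exact key t ⟨ht.1, htT⟩
  have htT' : t = T := le_antisymm ht.2 (not_lt.1 htT)
  rcases eq_or_lt_of_le hT with h2T | h2T
  · have ht2 : t = 2 := by rw [htT', ← h2T]
    subst ht2
    refine ⟨?_, fun i hi => (hi2 i hi).trans ?_⟩
    · have hK20pos : (0 : ℝ) ≤ 1 / K ^ 20 := by positivity
      rw [r6]; linarith
    · exact div_le_div_of_nonneg_right (by norm_num) (by positivity)
  · rw [htT']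
    refine ⟨?_, fun i hi => ?_⟩
    · exact Ignition.le_at_right_of_Ico (g := fun s => |Y s 4 - 1|)
        (((Ignition.continuous_coord hY 4).sub continuous_const).abs) h2T fun s hs => (key s hs).1
    · exact Ignition.le_at_right_of_Ico (g := fun s => |Y s i|)
        ((Ignition.continuous_coord hY i).abs) h2T fun s hs => (key s hs).2 i hi

/-- **The cell's seed-scale question at exponent `6`, for differentiable pseudo-orbits.** For every
member under the standing hypotheses and every differentiable approximate trajectory `Y`
(velocity `V`, sup-defect `≤ δ` and sup-norm `≤ 2` on `[0,T)`, `T ≥ 2`) issued `δ₀`-close to (5.6)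
with the structured budget `δ₀ + δT ≤ ε²e^{-M}/K⁶`: fired with tolerance `1/4` at every time in
`[2, T]` — literally the conclusion of `PseudoOrbitTransitionSeed 6` (NegativeKickSharp.lean), which
asks the same of RIGHT-differentiable pseudo-orbits (`IsPseudoOrbit`) and stays undecided for those
here. [cite: Tao2016AveragedNS, §5.5 Theorem 5.3] -/
theorem approxTrajectory_seedBudget_fires (K M ε δ δ₀ T : ℝ) (Y V : ℝ → Fin 5 → ℝ)
    (hK : 2 * 20 ^ 42 * (Nat.factorial 42 : ℝ) + 16 ≤ K) (hML : 3000 * Real.log K ≤ M)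
    (hMK : M ≤ K ^ 10) (hε : 0 < ε) (hεle : ε ≤ exp (-(10 * M)) / K ^ 100) (hT : 2 ≤ T)
    (hY : ∀ t, HasDerivAt Y (V t) t)
    (hV : ∀ t ∈ Ico 0 T, ‖V t - delayCircuitWith K M ε (Y t)‖ ≤ δ)
    (hR : ∀ t ∈ Ico 0 T, ‖Y t‖ ≤ 2) (h0 : ‖Y 0 - delayInit‖ ≤ δ₀)
    (hB : δ₀ + δ * T ≤ ε ^ 2 * exp (-M) / K ^ 6) :
    ∀ t ∈ Icc 2 T, |Y t 4 - 1| ≤ 1 / 4 ∧ ∀ i : Fin 5, i ≠ 4 → |Y t i| ≤ 1 / 4 := by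
  obtain ⟨hK16, -, -, -, -, -⟩ := negKick_params hK hML hMK hε hεle
  have hK1 : (1 : ℝ) ≤ K := by linarith
  have h20 : (256 : ℝ) ≤ K ^ 20 :=
    le_trans (by nlinarith) (pow_le_pow_right₀ hK1 (by norm_num : 2 ≤ 20))
  have h10 : (16 : ℝ) ≤ K ^ 10 := le_trans hK16 (le_self_pow₀ hK1 (by norm_num))
  have h6 : (6 : ℝ) / K ^ 20 ≤ 1 / 4 := by rw [div_le_iff₀ (by positivity)]; linarith
  have h4 : (4 : ℝ) / K ^ 10 ≤ 1 / 4 := by rw [div_le_iff₀ (by positivity)]; linarith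
  intro t ht
  obtain ⟨he, hi⟩ := approxTrajectory_fired_from_two K M ε δ δ₀ T Y V hK hML hMK hε hεle hT hY hV
    hR h0 (hB.trans (Ignition.seedBudget_pow_le hK hML hMK hε hεle)) t ht
  exact ⟨he.trans h6, fun i hi' => (hi i hi').trans h4⟩

/-! ## §6. The seed-scale question over differentiable approximate trajectories: `q = 6` -/

/-- The cell's seed-scale question (`PseudoOrbitTransitionSeed q`, NegativeKickSharp.lean) posed
over DIFFERENTIABLE approximate trajectories — a velocity `V` with `∂ₜY = V` everywhere (two-sided)
and defect `‖V - F(Y)‖ ≤ δ` on `[0,T)` against a member — instead of pseudo-orbits (right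
derivatives on `[0,T)`, continuity on `[0,T]`): budget `δ₀ + δT ≤ ε²e^{-M}/K^q`, conclusion "fired
with tolerance `1/4` at every time of `[2,T]`". The producers of gate pseudo-orbits in the tree start
from such trajectories (`IsPseudoOrbit.of_hasDerivAt`, GateCertificateWith.lean). Typed cell
question; implied by `PseudoOrbitTransitionSeed q` (`PseudoOrbitTransitionSeed.approx`) and DECIDED
BELOW for `q = 6` (hence every `q ≥ 6`): true. [cite: Tao2016AveragedNS, Theorem 5.3] -/
def ApproxTrajectoryTransitionSeed (q : ℕ) : Prop :=
  ∀ (K M ε δ δ₀ T : ℝ) (Y V : ℝ → Fin 5 → ℝ),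
    2 * 20 ^ 42 * (Nat.factorial 42 : ℝ) + 16 ≤ K → 3000 * Real.log K ≤ M → M ≤ K ^ 10 →
    0 < ε → ε ≤ Real.exp (-(10 * M)) / K ^ 100 → 2 ≤ T → 0 ≤ δ₀ → 0 ≤ δ →
    (∀ t, HasDerivAt Y (V t) t) → (∀ t ∈ Ico 0 T, ‖V t - delayCircuitWith K M ε (Y t)‖ ≤ δ) →
    (∀ t ∈ Ico 0 T, ‖Y t‖ ≤ 2) → ‖Y 0 - delayInit‖ ≤ δ₀ →
    δ₀ + δ * T ≤ ε ^ 2 * Real.exp (-M) / K ^ q →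
    ∀ t ∈ Icc 2 T, |Y t 4 - 1| ≤ 1 / 4 ∧ ∀ i : Fin 5, i ≠ 4 → |Y t i| ≤ 1 / 4

/-- A differentiable approximate trajectory of a field, with defect `δ` and sup-norm `≤ R` on
`[0,T)`, is a `δ`-pseudo-orbit. [cite: HairerNorsettWanner1993, §I.10] -/
theorem IsPseudoOrbit.of_hasDerivAt_approx {m : ℕ} {F : (Fin m → ℝ) → (Fin m → ℝ)} {δ : ℝ}
    {R : ℝ≥0} {T : ℝ} {X W : ℝ → Fin m → ℝ} (hX : ∀ t, HasDerivAt X (W t) t)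
    (hW : ∀ t ∈ Ico 0 T, ‖W t - F (X t)‖ ≤ δ) (hR : ∀ t ∈ Ico 0 T, ‖X t‖ ≤ (R : ℝ)) :
    IsPseudoOrbit F δ R T X where
  continuousOn := (continuous_iff_continuousAt.2 fun t => (hX t).continuousAt).continuousOn
  defect t ht := ⟨W t, (hX t).hasDerivWithinAt, hW t ht⟩
  norm_le := hR

/-- The pseudo-orbit form of the seed-scale question implies the differentiable form. [folklore] -/
theorem PseudoOrbitTransitionSeed.approx {q : ℕ} (h : PseudoOrbitTransitionSeed q) :
    ApproxTrajectoryTransitionSeed q :=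
  fun K M ε δ δ₀ T Y V hK hML hMK hε hεle hT hδ₀ hδ hY hV hR h0 hb =>
    h K M ε δ δ₀ T Y hK hML hMK hε hεle hT hδ₀ hδ
      (IsPseudoOrbit.of_hasDerivAt_approx hY hV fun t ht => by simpa using hR t ht) h0 hb

/-- Monotonicity in the exponent. [folklore] -/
theorem ApproxTrajectoryTransitionSeed.mono {q q' : ℕ} (hq : q ≤ q')
    (h : ApproxTrajectoryTransitionSeed q) : ApproxTrajectoryTransitionSeed q' := by
  intro K M ε δ δ₀ T Y V hK hML hMK hε hεle hT hδ₀ hδ hY hV hR h0 hb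
  refine h K M ε δ δ₀ T Y V hK hML hMK hε hεle hT hδ₀ hδ hY hV hR h0 (hb.trans ?_)
  have hK1 : (1 : ℝ) ≤ K := by
    have : (0 : ℝ) ≤ 2 * 20 ^ 42 * (Nat.factorial 42 : ℝ) := by positivity
    linarith
  exact div_le_div_of_nonneg_left (by positivity) (by positivity) (pow_le_pow_right₀ hK1 hq)

/-- **The seed-scale question over differentiable approximate trajectories holds at `q = 6`**
(`approxTrajectory_seedBudget_fires`). [cite: Tao2016AveragedNS, §5.5 Theorem 5.3] -/
theorem approxTrajectoryTransitionSeed_six : ApproxTrajectoryTransitionSeed 6 :=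
  fun K M ε δ δ₀ T Y V hK hML hMK hε hεle hT _ _ hY hV hR h0 hb =>
    approxTrajectory_seedBudget_fires K M ε δ δ₀ T Y V hK hML hMK hε hεle hT hY hV hR h0 hb

/-- … hence at every `q ≥ 6`. [cite: Tao2016AveragedNS, §5.5 Theorem 5.3] -/
theorem approxTrajectoryTransitionSeed_of_six_le {q : ℕ} (hq : 6 ≤ q) :
    ApproxTrajectoryTransitionSeed q :=
  approxTrajectoryTransitionSeed_six.mono hq

end Literature.Analysis.FluidPDE.Tao2016AveragedNS
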